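import Literature.Barriers.CriticalPhenomena.PlaquetteWalkAngleZeroCount
import Mathlib.Algebra.Polynomial.Degree.Domain
import HarnessLib

/-!
# Barrier catalogue (SAWScalingLimit): the `Z → ∞` end of the printed Yang–Baxter family — exact degree and leading
coefficient of the vertex-functional polynomial, walk by walk («LIMIT COEFFICIENT»)

The tree (`PlaquetteWalkAngleZeroCount`) clears denominators in the printed vertex functional of
[GlazmanManolescu2019, Lemma 2.1 / eq. (1)]: in the variable `Z = e^{3iθ/8}`,
`(Z²·weightDen θ)^K · VF_{Dl}(a, f₀; θ) = P(Z)` with `P = ybVFPoly Dl a f₀ K` of degree `≤ 4K + 1` (`K ≥ maxExp`).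
This file computes the TOP of `P` exactly.

* The six cleared weight polynomials have exact degrees `deg(Z²·Den) = deg(Z²·v·Den) = deg(Z²·w₁·Den) =
  deg(Z²·w₂·Den) = 4` but `deg(Z²·u₁·Den) = deg(Z²·u₂·Den) = 3` (`natDegree_yb*Poly`), with non-zero leading
  coefficients; relative to the denominator the leading coefficients are the LIMIT WEIGHTS of the family at `Z → ∞`
  (i.e. `θ → −i∞`): `v ↦ 1`, `w₁ ↦ e^{−5iπ/4} = e^{3iπ/4}`, `w₂ ↦ e^{5iπ/4}`, while a plaquette carrying ONE corner
  arc (`u₁` or `u₂`) costs one power of `Z` (`leadingCoeff_ybVPoly`, `leadingCoeff_ybW1Poly`, `leadingCoeff_ybW2Poly`,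
  `leadingCoeff_ybU1Poly`, `leadingCoeff_ybU2Poly`).
* Hence the polynomial term of a walk `γ` ending on the slot `s` of `f₀` (`termPoly`) has EXACT degree
  `4K + 1 − cost_s(γ)` (`natDegree_termPoly_add_cost`), where the LIMIT COST
  `cost_s(γ) = #{plaquettes of γ with exactly one corner arc} + [s is a vertical side E/W]` (`cost`; the slot
  coefficient `r(θ) = e^{5iπ/16}·Z` of the horizontal sides N/S gains one degree), and an explicit non-zero leading
  coefficient (`leadingCoeff_termPoly`, `leadingCoeff_termPoly_ne_zero`).
* ★ TOP-DOWN TRUNCATION (`ybVFPoly_coeff_eq_sum_filter_cost_le`, `ybVFPoly_coeff_eq_limitCoeff_add`): the coefficient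
  of `Z^{4K+1−j}` in `P` only sees the walks of cost `≤ j`; the walks of cost exactly `j` contribute their leading
  coefficients — the LIMIT COEFFICIENT `limitCoeff Dl a f₀ K j` (a finite sum of unit-type complex numbers) — and the
  walks of smaller cost contribute lower coefficients of their terms. In particular `deg P ≤ 4K + 1 − j` whenever every
  walk costs at least `j` (`natDegree_ybVFPoly_le_of_le_cost`), and at that level the coefficient IS the limit
  coefficient (`ybVFPoly_coeff_eq_limitCoeff_of_le_cost`).
* ★★ THE CRITERION (`vertexFunctional_printed_zero_set_finite_of_coeff_ne_zero`,
  `…_of_limitCoeff_ne_zero`): ONE non-vanishing coefficient of `P` — in particular a non-vanishing limit coefficient at a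
  level below which every walk term vanishes — makes the printed vertex functional NOT identically zero in the angle: its
  zero set in `(0, π)` is finite, with at most `deg P` elements.

Use (venture lane «pcv-sawmu», FINDING-YB-LIMIT-MODEL): the open sufficient half of the encircling criterion («a wound
class-B2a walk at `f₀` ⇒ `VF ≢ 0`») is invisible at any single angle (mirror zeros at `π/2`, double hexagonal zeros at
`π/3` and `2π/3`); at `Z → ∞` the first non-vanishing coefficient from the top is, on every enumerated domain, the limit
coefficient of the minimal-cost WOUND walks, and it never vanished (the lane's census). This file supplies the exact
algebra of that end of the family; the identification of the surviving level with the wound sum is not made here.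
Elementary (degrees and leading coefficients of products of explicit quadratics over `ℂ`).
-/

noncomputable section

namespace Literature.Barriers.CriticalPhenomena.PlaquetteWalk

open Literature.Probability.RandomPlanarGeometry.SAW.YangBaxter
open Real Complex Polynomial

/-! ## Degrees and leading coefficients of the six cleared weight polynomials -/

section Factors

/-- `e^{iα}·i/2 ≠ 0`. [folklore] -/
private theorem expI_mul_I_div_two_ne_zero (α : ℂ) : Complex.exp (α * I) * I / 2 ≠ 0 :=
  div_ne_zero (mul_ne_zero (Complex.exp_ne_zero _) Complex.I_ne_zero) two_ne_zero

/-- A polynomial `C a − C b·X²` with `b ≠ 0` has degree `2` and leading coefficient `−b`. [folklore] -/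
private theorem natDegree_C_sub_C_mul_X_sq {a b : ℂ} (hb : b ≠ 0) :
    (C a - C b * X ^ 2 : ℂ[X]).natDegree = 2 ∧ (C a - C b * X ^ 2 : ℂ[X]).leadingCoeff = -b := by
  have e : (C a - C b * X ^ 2 : ℂ[X]) = C (-b) * X ^ 2 + C a := by
    rw [map_neg]; ring
  rw [e]
  have hd : (C (-b) * X ^ 2 + C a : ℂ[X]).natDegree = 2 := by
    have h1 : (C (-b) * X ^ 2 : ℂ[X]).natDegree = 2 := natDegree_C_mul_X_pow 2 (-b) (neg_ne_zero.2 hb)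
    have h2 : (C a : ℂ[X]).natDegree < (C (-b) * X ^ 2 : ℂ[X]).natDegree := by rw [h1, natDegree_C]; norm_num
    rw [natDegree_add_eq_left_of_natDegree_lt h2, h1]
  refine ⟨hd, ?_⟩
  rw [leadingCoeff, hd]
  simp [coeff_X_pow]

/-- A polynomial `C a·X² − C b` with `a ≠ 0` has degree `2` and leading coefficient `a`. [folklore] -/
private theorem natDegree_C_mul_X_sq_sub_C {a b : ℂ} (ha : a ≠ 0) :
    (C a * X ^ 2 - C b : ℂ[X]).natDegree = 2 ∧ (C a * X ^ 2 - C b : ℂ[X]).leadingCoeff = a := by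
  have hd : (C a * X ^ 2 - C b : ℂ[X]).natDegree = 2 := by
    rw [natDegree_sub_C, natDegree_C_mul_X_pow 2 a ha]
  refine ⟨hd, ?_⟩
  rw [leadingCoeff, hd]
  simp [coeff_X_pow]

/-- `deg P⁺_α = 2`. [cite: GlazmanManolescu2019, §1, eq. (1) (the weights are quotients of products of sines of the angle)] -/
theorem natDegree_sinPolyP (α : ℝ) : (sinPolyP α).natDegree = 2 :=
  (natDegree_C_sub_C_mul_X_sq (expI_mul_I_div_two_ne_zero α)).1

/-- `lead P⁺_α = −e^{iα}·i/2`. [cite: GlazmanManolescu2019, §1, eq. (1)] -/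
theorem leadingCoeff_sinPolyP (α : ℝ) :
    (sinPolyP α).leadingCoeff = -(Complex.exp ((α : ℂ) * I) * I / 2) :=
  (natDegree_C_sub_C_mul_X_sq (expI_mul_I_div_two_ne_zero α)).2

/-- `e^{−iβ}·i/2 ≠ 0` (the form appearing in `P⁻_β`). [folklore] -/
private theorem expNegI_mul_I_div_two_ne_zero (β : ℂ) : Complex.exp (-(β * I)) * I / 2 ≠ 0 :=
  div_ne_zero (mul_ne_zero (Complex.exp_ne_zero _) Complex.I_ne_zero) two_ne_zero

/-- `deg P⁻_β = 2`. [cite: GlazmanManolescu2019, §1, eq. (1)] -/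
theorem natDegree_sinPolyM (β : ℝ) : (sinPolyM β).natDegree = 2 := by
  unfold sinPolyM
  exact (natDegree_C_mul_X_sq_sub_C (b := Complex.exp ((β : ℂ) * I) * I / 2) (expNegI_mul_I_div_two_ne_zero (β : ℂ))).1

/-- `lead P⁻_β = e^{−iβ}·i/2`. [cite: GlazmanManolescu2019, §1, eq. (1)] -/
theorem leadingCoeff_sinPolyM (β : ℝ) :
    (sinPolyM β).leadingCoeff = Complex.exp (-((β : ℂ) * I)) * I / 2 := by
  unfold sinPolyM
  exact (natDegree_C_mul_X_sq_sub_C (b := Complex.exp ((β : ℂ) * I) * I / 2) (expNegI_mul_I_div_two_ne_zero (β : ℂ))).2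

/-- `lead P⁺_α ≠ 0`. [cite: GlazmanManolescu2019, §1, eq. (1) (lane plumbing)] -/
theorem leadingCoeff_sinPolyP_ne_zero (α : ℝ) : (sinPolyP α).leadingCoeff ≠ 0 := by
  rw [leadingCoeff_sinPolyP]; exact neg_ne_zero.2 (expI_mul_I_div_two_ne_zero _)

/-- `lead P⁻_β ≠ 0`. [cite: GlazmanManolescu2019, §1, eq. (1) (lane plumbing)] -/
theorem leadingCoeff_sinPolyM_ne_zero (β : ℝ) : (sinPolyM β).leadingCoeff ≠ 0 := by
  rw [leadingCoeff_sinPolyM]; exact expNegI_mul_I_div_two_ne_zero _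

/-- `P⁺_α ≠ 0`. [cite: GlazmanManolescu2019, §1, eq. (1) (lane plumbing)] -/
theorem sinPolyP_ne_zero (α : ℝ) : sinPolyP α ≠ 0 :=
  fun h => leadingCoeff_sinPolyP_ne_zero α (by rw [h, leadingCoeff_zero])

/-- `P⁻_β ≠ 0`. [cite: GlazmanManolescu2019, §1, eq. (1) (lane plumbing)] -/
theorem sinPolyM_ne_zero (β : ℝ) : sinPolyM β ≠ 0 :=
  fun h => leadingCoeff_sinPolyM_ne_zero β (by rw [h, leadingCoeff_zero])

/-- `sin(5π/4) ≠ 0` (indeed `= −√2/2`). [folklore] -/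
private theorem sin_five_pi_div_four_ne_zero : Real.sin (5 * π / 4) ≠ 0 := by
  have e : Real.sin (5 * π / 4) = -Real.sin (π / 4) := by
    rw [show 5 * π / 4 = π / 4 + π by ring, Real.sin_add_pi]
  rw [e, Real.sin_pi_div_four]
  have : (0 : ℝ) < Real.sqrt 2 / 2 := by positivity
  linarith

/-- The constant `C(sin 5π/4)` as a complex number is non-zero. [folklore] -/
private theorem sinC_ne_zero : ((Real.sin (5 * π / 4) : ℝ) : ℂ) ≠ 0 := by
  exact_mod_cast sin_five_pi_div_four_ne_zero

/-- `deg(Z²·Den) = 4`. [cite: GlazmanManolescu2019, §1, eq. (1)] -/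
theorem natDegree_ybDenPoly : ybDenPoly.natDegree = 4 := by
  rw [ybDenPoly, natDegree_mul (sinPolyP_ne_zero _) (sinPolyM_ne_zero _), natDegree_sinPolyP, natDegree_sinPolyM]

/-- `lead(Z²·Den) = lead P⁺_{5π/4} · lead P⁻_{5π/8}` (`= e^{5iπ/8}/4`). [cite: GlazmanManolescu2019, §1, eq. (1)] -/
theorem leadingCoeff_ybDenPoly :
    ybDenPoly.leadingCoeff = (sinPolyP (5 * π / 4)).leadingCoeff * (sinPolyM (5 * π / 8)).leadingCoeff := by
  rw [ybDenPoly, leadingCoeff_mul]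

/-- `lead(Z²·Den) ≠ 0`. [cite: GlazmanManolescu2019, §1, eq. (1) (lane plumbing)] -/
theorem leadingCoeff_ybDenPoly_ne_zero : ybDenPoly.leadingCoeff ≠ 0 := by
  rw [leadingCoeff_ybDenPoly]; exact mul_ne_zero (leadingCoeff_sinPolyP_ne_zero _) (leadingCoeff_sinPolyM_ne_zero _)

/-- `Z²·Den ≠ 0` as a polynomial. [cite: GlazmanManolescu2019, §1, eq. (1) (lane plumbing)] -/
theorem ybDenPoly_ne_zero' : ybDenPoly ≠ 0 :=
  fun h => leadingCoeff_ybDenPoly_ne_zero (by rw [h, leadingCoeff_zero])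

/-- `deg(Z²·v·Den) = 4`. [cite: GlazmanManolescu2019, §1, eq. (1)] -/
theorem natDegree_ybVPoly : ybVPoly.natDegree = 4 := by
  rw [ybVPoly, natDegree_mul (sinPolyP_ne_zero _) (sinPolyM_ne_zero _), natDegree_sinPolyP, natDegree_sinPolyM]

/-- `deg(Z²·w₁·Den) = 4`. [cite: GlazmanManolescu2019, §1, eq. (1)] -/
theorem natDegree_ybW1Poly : ybW1Poly.natDegree = 4 := by
  rw [ybW1Poly, natDegree_mul (sinPolyP_ne_zero _) (sinPolyM_ne_zero _), natDegree_sinPolyP, natDegree_sinPolyM]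

/-- `deg(Z²·w₂·Den) = 4`. [cite: GlazmanManolescu2019, §1, eq. (1)] -/
theorem natDegree_ybW2Poly : ybW2Poly.natDegree = 4 := by
  rw [ybW2Poly, natDegree_mul (sinPolyP_ne_zero _) (sinPolyM_ne_zero _), natDegree_sinPolyP, natDegree_sinPolyM]

/-- `C(sin 5π/4)·X ≠ 0`, of degree `1`, leading coefficient `sin 5π/4`. [folklore] -/
private theorem CX_facts :
    (C ((Real.sin (5 * π / 4) : ℝ) : ℂ) * X : ℂ[X]) ≠ 0 ∧ (C ((Real.sin (5 * π / 4) : ℝ) : ℂ) * X : ℂ[X]).natDegree = 1 ∧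
      (C ((Real.sin (5 * π / 4) : ℝ) : ℂ) * X : ℂ[X]).leadingCoeff = ((Real.sin (5 * π / 4) : ℝ) : ℂ) := by
  refine ⟨?_, ?_, ?_⟩
  · exact mul_ne_zero (by rw [Ne, C_eq_zero]; exact sinC_ne_zero) X_ne_zero
  · rw [← pow_one (X : ℂ[X])]; exact natDegree_C_mul_X_pow 1 _ sinC_ne_zero
  · rw [← pow_one (X : ℂ[X])]; exact leadingCoeff_C_mul_X_pow _ 1

/-- `deg(Z²·u₁·Den) = 3` — ONE degree below the denominator: a plaquette with a single corner arc costs one power of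
`Z`. [cite: GlazmanManolescu2019, §1, eq. (1)] -/
theorem natDegree_ybU1Poly : ybU1Poly.natDegree = 3 := by
  obtain ⟨h0, h1, -⟩ := CX_facts
  rw [ybU1Poly, natDegree_mul h0 (sinPolyP_ne_zero _), h1, natDegree_sinPolyP]

/-- `deg(Z²·u₂·Den) = 3`. [cite: GlazmanManolescu2019, §1, eq. (1)] -/
theorem natDegree_ybU2Poly : ybU2Poly.natDegree = 3 := by
  obtain ⟨h0, h1, -⟩ := CX_facts
  rw [ybU2Poly, natDegree_mul h0 (sinPolyP_ne_zero _), h1, natDegree_sinPolyP]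

/-- `lead(Z²·u₁·Den) = sin(5π/4) · lead P⁺_{5π/8}`. [cite: GlazmanManolescu2019, §1, eq. (1)] -/
theorem leadingCoeff_ybU1Poly :
    ybU1Poly.leadingCoeff = ((Real.sin (5 * π / 4) : ℝ) : ℂ) * (sinPolyP (5 * π / 8)).leadingCoeff := by
  obtain ⟨-, -, h2⟩ := CX_facts
  rw [ybU1Poly, leadingCoeff_mul, h2]

/-- `lead(Z²·u₂·Den) = sin(5π/4) · lead P⁺_0`. [cite: GlazmanManolescu2019, §1, eq. (1)] -/
theorem leadingCoeff_ybU2Poly :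
    ybU2Poly.leadingCoeff = ((Real.sin (5 * π / 4) : ℝ) : ℂ) * (sinPolyP 0).leadingCoeff := by
  obtain ⟨-, -, h2⟩ := CX_facts
  rw [ybU2Poly, leadingCoeff_mul, h2]

/-- `lead(Z²·u₁·Den) ≠ 0`. [cite: GlazmanManolescu2019, §1, eq. (1) (lane plumbing)] -/
theorem leadingCoeff_ybU1Poly_ne_zero : ybU1Poly.leadingCoeff ≠ 0 := by
  rw [leadingCoeff_ybU1Poly]; exact mul_ne_zero sinC_ne_zero (leadingCoeff_sinPolyP_ne_zero _)

/-- `lead(Z²·u₂·Den) ≠ 0`. [cite: GlazmanManolescu2019, §1, eq. (1) (lane plumbing)] -/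
theorem leadingCoeff_ybU2Poly_ne_zero : ybU2Poly.leadingCoeff ≠ 0 := by
  rw [leadingCoeff_ybU2Poly]; exact mul_ne_zero sinC_ne_zero (leadingCoeff_sinPolyP_ne_zero _)

/-- ★ LIMIT WEIGHT `v ↦ 1`: `lead(Z²·v·Den) = lead(Z²·Den)`. [cite: GlazmanManolescu2019, §1, eq. (1)] -/
theorem leadingCoeff_ybVPoly : ybVPoly.leadingCoeff = ybDenPoly.leadingCoeff := by
  rw [ybVPoly, ybDenPoly, leadingCoeff_mul, leadingCoeff_mul, leadingCoeff_sinPolyP, leadingCoeff_sinPolyP,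
    leadingCoeff_sinPolyM, leadingCoeff_sinPolyM]
  have e : Complex.exp (((5 * π / 4 : ℝ) : ℂ) * I) * Complex.exp (-(((5 * π / 8 : ℝ) : ℂ) * I)) =
      Complex.exp (((5 * π / 8 : ℝ) : ℂ) * I) * Complex.exp (-(((0 : ℝ) : ℂ) * I)) := by
    rw [← Complex.exp_add, ← Complex.exp_add]; congr 1; push_cast; ring
  linear_combination (I / 2) * (I / 2) * (-1 : ℂ) * e.symm

/-- ★ LIMIT WEIGHT `w₁ ↦ e^{−5iπ/4}` (`= e^{3iπ/4}`): `lead(Z²·w₁·Den) = e^{−5iπ/4} · lead(Z²·Den)`.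
[cite: GlazmanManolescu2019, §1, eq. (1)] -/
theorem leadingCoeff_ybW1Poly :
    ybW1Poly.leadingCoeff = Complex.exp (-(((5 * π / 4 : ℝ) : ℂ) * I)) * ybDenPoly.leadingCoeff := by
  rw [ybW1Poly, ybDenPoly, leadingCoeff_mul, leadingCoeff_mul, leadingCoeff_sinPolyP, leadingCoeff_sinPolyP,
    leadingCoeff_sinPolyM, leadingCoeff_sinPolyM]
  have e : Complex.exp (((5 * π / 8 : ℝ) : ℂ) * I) * Complex.exp (-(((5 * π / 4 : ℝ) : ℂ) * I)) =
      Complex.exp (-(((5 * π / 4 : ℝ) : ℂ) * I)) *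
        (Complex.exp (((5 * π / 4 : ℝ) : ℂ) * I) * Complex.exp (-(((5 * π / 8 : ℝ) : ℂ) * I))) := by
    rw [← Complex.exp_add, ← Complex.exp_add, ← Complex.exp_add]; congr 1; push_cast; ring
  linear_combination (I / 2) * (I / 2) * (-1 : ℂ) * e

/-- ★ LIMIT WEIGHT `w₂ ↦ e^{5iπ/4}`: `lead(Z²·w₂·Den) = e^{5iπ/4} · lead(Z²·Den)`.
[cite: GlazmanManolescu2019, §1, eq. (1)] -/
theorem leadingCoeff_ybW2Poly :
    ybW2Poly.leadingCoeff = Complex.exp (((5 * π / 4 : ℝ) : ℂ) * I) * ybDenPoly.leadingCoeff := by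
  rw [ybW2Poly, ybDenPoly, leadingCoeff_mul, leadingCoeff_mul, leadingCoeff_sinPolyP, leadingCoeff_sinPolyP,
    leadingCoeff_sinPolyM, leadingCoeff_sinPolyM]
  have e : Complex.exp (((15 * π / 8 : ℝ) : ℂ) * I) * Complex.exp (-(((0 : ℝ) : ℂ) * I)) =
      Complex.exp (((5 * π / 4 : ℝ) : ℂ) * I) *
        (Complex.exp (((5 * π / 4 : ℝ) : ℂ) * I) * Complex.exp (-(((5 * π / 8 : ℝ) : ℂ) * I))) := by
    rw [← Complex.exp_add, ← Complex.exp_add, ← Complex.exp_add]; congr 1; push_cast; ring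
  linear_combination (I / 2) * (I / 2) * (-1 : ℂ) * e

/-- ★ LIMIT WEIGHT of a single corner arc: `lead(Z²·u₁·Den) = (−2i·sin 5π/4) · lead(Z²·Den)` (`= i√2 · lead(Z²·Den)`;
the term sits one degree lower). [cite: GlazmanManolescu2019, §1, eq. (1)] -/
theorem leadingCoeff_ybU1Poly_eq :
    ybU1Poly.leadingCoeff = (-2 * I * ((Real.sin (5 * π / 4) : ℝ) : ℂ)) * ybDenPoly.leadingCoeff := by
  rw [leadingCoeff_ybU1Poly, ybDenPoly, leadingCoeff_mul, leadingCoeff_sinPolyP, leadingCoeff_sinPolyP,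
    leadingCoeff_sinPolyM]
  have e : Complex.exp (((5 * π / 8 : ℝ) : ℂ) * I) =
      Complex.exp (((5 * π / 4 : ℝ) : ℂ) * I) * Complex.exp (-(((5 * π / 8 : ℝ) : ℂ) * I)) := by
    rw [← Complex.exp_add]; congr 1; push_cast; ring
  rw [e]
  have hI : I * I = -1 := Complex.I_mul_I
  linear_combination (-(((Real.sin (5 * π / 4) : ℝ) : ℂ) * (Complex.exp (((5 * π / 4 : ℝ) : ℂ) * I) *
    Complex.exp (-(((5 * π / 8 : ℝ) : ℂ) * I))) * I / 2)) * hI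

/-- ★ LIMIT WEIGHT of a single co-corner arc: `lead(Z²·u₂·Den) = (−2i·sin 5π/4)·e^{−5iπ/8} · lead(Z²·Den)`.
[cite: GlazmanManolescu2019, §1, eq. (1)] -/
theorem leadingCoeff_ybU2Poly_eq :
    ybU2Poly.leadingCoeff =
      (-2 * I * ((Real.sin (5 * π / 4) : ℝ) : ℂ)) * Complex.exp (-(((5 * π / 8 : ℝ) : ℂ) * I)) * ybDenPoly.leadingCoeff := by
  rw [leadingCoeff_ybU2Poly, ybDenPoly, leadingCoeff_mul, leadingCoeff_sinPolyP, leadingCoeff_sinPolyP,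
    leadingCoeff_sinPolyM]
  have e : Complex.exp (((0 : ℝ) : ℂ) * I) =
      Complex.exp (((5 * π / 4 : ℝ) : ℂ) * I) * Complex.exp (-(((5 * π / 8 : ℝ) : ℂ) * I)) ^ 2 := by
    rw [sq, ← Complex.exp_add, ← Complex.exp_add]; congr 1; push_cast; ring
  rw [e]
  have hI : I * I = -1 := Complex.I_mul_I
  linear_combination (-(((Real.sin (5 * π / 4) : ℝ) : ℂ) * (Complex.exp (((5 * π / 4 : ℝ) : ℂ) * I) *
    Complex.exp (-(((5 * π / 8 : ℝ) : ℂ) * I)) ^ 2) * I / 2)) * hI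

end Factors

/-! ## The slot coefficients -/

section Slots

/-- The unit `e^{5iπ/16}` of the slot coefficient `r(θ) = e^{5iπ/16}·Z`. [cite: GlazmanManolescu2019, Lemma 2.1, eq. (CR)] -/
def slotUnit : ℂ := Complex.exp (((5 * π / 16 : ℝ) : ℂ) * I)

/-- `e^{5iπ/16} ≠ 0`. [cite: GlazmanManolescu2019, Lemma 2.1, eq. (CR) (lane plumbing)] -/
theorem slotUnit_ne_zero : slotUnit ≠ 0 := Complex.exp_ne_zero _

/-- The degree of the slot coefficient: `1` on the horizontal sides `N, S` (slots `1, 3`, coefficient `±r(θ)`), `0` on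
the vertical sides `E, W` (slots `0, 2`, coefficient `±1`). [cite: GlazmanManolescu2019, Lemma 2.1, eq. (CR)] -/
def slotDeg (s : Fin 4) : ℕ := if s = 1 ∨ s = 3 then 1 else 0

/-- The leading coefficient of the slot coefficient: `(1, e^{5iπ/16}, −1, −e^{5iπ/16})`.
[cite: GlazmanManolescu2019, Lemma 2.1, eq. (CR)] -/
def slotLead (s : Fin 4) : ℂ := ![1, slotUnit, -1, -slotUnit] s

/-- `slotLead s ≠ 0`. [cite: GlazmanManolescu2019, Lemma 2.1, eq. (CR) (lane plumbing)] -/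
theorem slotLead_ne_zero (s : Fin 4) : slotLead s ≠ 0 := by
  fin_cases s <;> simp [slotLead, slotUnit_ne_zero]

/-- `deg(ybCoeffPoly s) = slotDeg s`. [cite: GlazmanManolescu2019, Lemma 2.1, eq. (CR)] -/
theorem natDegree_ybCoeffPoly (s : Fin 4) : (ybCoeffPoly s).natDegree = slotDeg s := by
  have hu : Complex.exp (((5 * π / 16 : ℝ) : ℂ) * I) ≠ 0 := Complex.exp_ne_zero _
  fin_cases s
  · simp [ybCoeffPoly, slotDeg]
  · simp only [ybCoeffPoly, slotDeg, Fin.mk_one, Matrix.cons_val_one, Matrix.cons_val_zero, Fin.isValue]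
    rw [← pow_one (X : ℂ[X]), natDegree_C_mul_X_pow 1 _ hu]; simp
  · simp only [ybCoeffPoly, slotDeg, Fin.reduceFinMk, Matrix.cons_val]
    rw [natDegree_C]; simp
  · simp only [ybCoeffPoly, slotDeg, Fin.reduceFinMk, Matrix.cons_val]
    rw [← pow_one (X : ℂ[X]), natDegree_C_mul_X_pow 1 _ (neg_ne_zero.2 hu)]; simp

/-- `lead(ybCoeffPoly s) = slotLead s`. [cite: GlazmanManolescu2019, Lemma 2.1, eq. (CR)] -/
theorem leadingCoeff_ybCoeffPoly (s : Fin 4) : (ybCoeffPoly s).leadingCoeff = slotLead s := by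
  fin_cases s
  · simp [ybCoeffPoly, slotLead]
  · simp only [ybCoeffPoly, slotLead, slotUnit, Fin.mk_one, Matrix.cons_val_one, Matrix.cons_val_zero, Fin.isValue]
    rw [← pow_one (X : ℂ[X]), leadingCoeff_C_mul_X_pow]
  · simp only [ybCoeffPoly, slotLead, Fin.reduceFinMk, Matrix.cons_val]
    rw [leadingCoeff_C]
  · simp only [ybCoeffPoly, slotLead, slotUnit, Fin.reduceFinMk, Matrix.cons_val]
    rw [← pow_one (X : ℂ[X]), leadingCoeff_C_mul_X_pow]

/-- `ybCoeffPoly s ≠ 0`. [cite: GlazmanManolescu2019, Lemma 2.1, eq. (CR) (lane plumbing)] -/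
theorem ybCoeffPoly_ne_zero (s : Fin 4) : ybCoeffPoly s ≠ 0 := fun h =>
  slotLead_ne_zero s (by rw [← leadingCoeff_ybCoeffPoly, h, leadingCoeff_zero])

end Slots

/-! ## The polynomial term of a walk: exact degree `4K + 1 − cost` and its leading coefficient -/

section Terms

/-- ★ **The limit cost** of a mid-edge list ending on the slot `s`: the number of visited plaquettes carrying exactly ONE
corner arc (`u₁` or `u₂`), plus one if the slot is a vertical side (`E`, `W`). [cite: GlazmanManolescu2019, §1, Fig. 1 and eq. (1) (the five local configurations); Lemma 2.1, eq. (CR) (the slot coefficients)] -/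
def cost (s : Fin 4) (l : List MidEdge) : ℕ := cfgCount l [.corner] + cfgCount l [.coCorner] + (1 - slotDeg s)

/-- **The polynomial term of a walk** in the cleared vertex functional: slot coefficient × phase × weight polynomial ×
the denominator raised to the unused budget. [cite: GlazmanManolescu2019, Lemma 2.1 and eq. (1)] -/
def termPoly (s : Fin 4) (l : List MidEdge) (K : ℕ) : ℂ[X] :=
  ybCoeffPoly s * (C (tFiveEighths ^ quarterTurnsL l) * ybWalkPoly l * ybDenPoly ^ (K - totalExp l))

/-- **The cleared vertex functional is the sum of the walk terms.** [cite: GlazmanManolescu2019, Lemma 2.1] -/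
theorem ybVFPoly_eq_sum_termPoly (Dl : List Face) (a : MidEdge) (f₀ : Face) (K : ℕ) :
    ybVFPoly Dl a f₀ K = ∑ s : Fin 4, ∑ γ : YBWalk (dom Dl) a (slotSide f₀ s), termPoly s γ.mids K := by
  unfold ybVFPoly ybObsPoly termPoly
  simp only [Finset.mul_sum]

/-- The phase constant `C(t^q) ≠ 0`. [folklore] -/
private theorem C_tpow_ne_zero (q : ℤ) : (C (tFiveEighths ^ q) : ℂ[X]) ≠ 0 := by
  rw [Ne, C_eq_zero]; exact zpow_ne_zero _ tFiveEighths_ne_zero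

/-- `Z²·u₁·Den ≠ 0`, …: the five cleared weight polynomials are non-zero. [folklore] -/
private theorem factors_ne_zero :
    ybU1Poly ≠ 0 ∧ ybU2Poly ≠ 0 ∧ ybVPoly ≠ 0 ∧ ybW1Poly ≠ 0 ∧ ybW2Poly ≠ 0 := by
  refine ⟨fun h => ?_, fun h => ?_, fun h => ?_, fun h => ?_, fun h => ?_⟩
  · exact leadingCoeff_ybU1Poly_ne_zero (by rw [h, leadingCoeff_zero])
  · exact leadingCoeff_ybU2Poly_ne_zero (by rw [h, leadingCoeff_zero])
  · have := natDegree_ybVPoly; rw [h, natDegree_zero] at this; exact absurd this (by norm_num)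
  · have := natDegree_ybW1Poly; rw [h, natDegree_zero] at this; exact absurd this (by norm_num)
  · have := natDegree_ybW2Poly; rw [h, natDegree_zero] at this; exact absurd this (by norm_num)

/-- `deg(ybWalkPoly l) = 3n₁ + 3n₂ + 4n_v + 4n_{w₁} + 4n_{w₂}`. [cite: GlazmanManolescu2019, §1, eq. (1)] -/
theorem natDegree_ybWalkPoly (l : List MidEdge) :
    (ybWalkPoly l).natDegree = 3 * cfgCount l [.corner] + 3 * cfgCount l [.coCorner] + 4 * cfgCount l [.straight] +
      4 * cfgCount l [.corner, .corner] + 4 * cfgCount l [.coCorner, .coCorner] := by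
  obtain ⟨h1, h2, h3, h4, h5⟩ := factors_ne_zero
  unfold ybWalkPoly
  rw [natDegree_mul (mul_ne_zero (mul_ne_zero (mul_ne_zero (pow_ne_zero _ h1) (pow_ne_zero _ h2)) (pow_ne_zero _ h3))
      (pow_ne_zero _ h4)) (pow_ne_zero _ h5),
    natDegree_mul (mul_ne_zero (mul_ne_zero (pow_ne_zero _ h1) (pow_ne_zero _ h2)) (pow_ne_zero _ h3)) (pow_ne_zero _ h4),
    natDegree_mul (mul_ne_zero (pow_ne_zero _ h1) (pow_ne_zero _ h2)) (pow_ne_zero _ h3),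
    natDegree_mul (pow_ne_zero _ h1) (pow_ne_zero _ h2), natDegree_pow, natDegree_pow, natDegree_pow, natDegree_pow,
    natDegree_pow, natDegree_ybU1Poly, natDegree_ybU2Poly, natDegree_ybVPoly, natDegree_ybW1Poly, natDegree_ybW2Poly]
  ring

/-- `ybWalkPoly l ≠ 0`. [cite: GlazmanManolescu2019, §1, eq. (1) (lane plumbing)] -/
theorem ybWalkPoly_ne_zero (l : List MidEdge) : ybWalkPoly l ≠ 0 := by
  obtain ⟨h1, h2, h3, h4, h5⟩ := factors_ne_zero
  unfold ybWalkPoly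
  exact mul_ne_zero (mul_ne_zero (mul_ne_zero (mul_ne_zero (pow_ne_zero _ h1) (pow_ne_zero _ h2)) (pow_ne_zero _ h3))
    (pow_ne_zero _ h4)) (pow_ne_zero _ h5)

/-- `termPoly s l K ≠ 0`. [cite: GlazmanManolescu2019, §1, eq. (1) (lane plumbing)] -/
theorem termPoly_ne_zero (s : Fin 4) (l : List MidEdge) (K : ℕ) : termPoly s l K ≠ 0 :=
  mul_ne_zero (ybCoeffPoly_ne_zero s) (mul_ne_zero (mul_ne_zero (C_tpow_ne_zero _) (ybWalkPoly_ne_zero l))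
    (pow_ne_zero _ ybDenPoly_ne_zero'))

/-- ★★ **EXACT DEGREE OF A WALK TERM**: `deg(termPoly_s(γ)) + cost_s(γ) = 4K + 1` for every mid-edge list within the
budget (`totalExp ≤ K`). Every plaquette with a single corner arc, and a vertical end-side, costs one power of `Z`.
[cite: GlazmanManolescu2019, §1, eq. (1); Lemma 2.1, eq. (CR)] -/
theorem natDegree_termPoly_add_cost (s : Fin 4) {l : List MidEdge} {K : ℕ} (h : totalExp l ≤ K) :
    (termPoly s l K).natDegree + cost s l = 4 * K + 1 := by
  have hs : slotDeg s ≤ 1 := by unfold slotDeg; split_ifs <;> simp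
  unfold termPoly cost
  rw [natDegree_mul (ybCoeffPoly_ne_zero s) (mul_ne_zero (mul_ne_zero (C_tpow_ne_zero _) (ybWalkPoly_ne_zero l))
      (pow_ne_zero _ ybDenPoly_ne_zero')),
    natDegree_mul (mul_ne_zero (C_tpow_ne_zero _) (ybWalkPoly_ne_zero l)) (pow_ne_zero _ ybDenPoly_ne_zero'),
    natDegree_mul (C_tpow_ne_zero _) (ybWalkPoly_ne_zero l), natDegree_C, natDegree_pow, natDegree_ybDenPoly,
    natDegree_ybWalkPoly, natDegree_ybCoeffPoly]
  unfold totalExp at h ⊢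
  omega

/-- The degree of a walk term as a difference. [cite: GlazmanManolescu2019, §1, eq. (1); Lemma 2.1] -/
theorem natDegree_termPoly (s : Fin 4) {l : List MidEdge} {K : ℕ} (h : totalExp l ≤ K) :
    (termPoly s l K).natDegree = 4 * K + 1 - cost s l := by
  have := natDegree_termPoly_add_cost s h; omega

/-- The cost never exceeds `4K + 1` within the budget. [cite: GlazmanManolescu2019, §1, eq. (1) (lane plumbing)] -/
theorem cost_le (s : Fin 4) {l : List MidEdge} {K : ℕ} (h : totalExp l ≤ K) : cost s l ≤ 4 * K + 1 := by
  have := natDegree_termPoly_add_cost s h; omega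

/-- **The leading coefficient of a walk term** as the product of the factor leading coefficients.
[cite: GlazmanManolescu2019, §1, eq. (1); Lemma 2.1, eq. (CR)] -/
theorem leadingCoeff_termPoly (s : Fin 4) (l : List MidEdge) (K : ℕ) :
    (termPoly s l K).leadingCoeff =
      slotLead s * tFiveEighths ^ quarterTurnsL l *
        (ybU1Poly.leadingCoeff ^ cfgCount l [.corner] * ybU2Poly.leadingCoeff ^ cfgCount l [.coCorner] *
          ybVPoly.leadingCoeff ^ cfgCount l [.straight] * ybW1Poly.leadingCoeff ^ cfgCount l [.corner, .corner] *
            ybW2Poly.leadingCoeff ^ cfgCount l [.coCorner, .coCorner]) *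
        ybDenPoly.leadingCoeff ^ (K - totalExp l) := by
  unfold termPoly ybWalkPoly
  simp only [leadingCoeff_mul, leadingCoeff_pow, leadingCoeff_C, leadingCoeff_ybCoeffPoly]
  ring

/-- The leading coefficient of a walk term is non-zero. [cite: GlazmanManolescu2019, §1, eq. (1) (lane plumbing)] -/
theorem leadingCoeff_termPoly_ne_zero (s : Fin 4) (l : List MidEdge) (K : ℕ) : (termPoly s l K).leadingCoeff ≠ 0 :=
  leadingCoeff_ne_zero.2 (termPoly_ne_zero s l K)

/-- ★ **THE LIMIT WEIGHT of a mid-edge list at a slot**: slot unit × phase `t^q` × `(−2i·sin 5π/4)^{n₁+n₂}` ×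
`e^{−5iπ n₂/8}` × `e^{−5iπ n_{w₁}/4}` × `e^{5iπ n_{w₂}/4}` — the weight of the walk in the `Z → ∞` limit model (straight
plaquettes weigh `1`, doubly visited plaquettes a unit, single corners the constant `i√2` per lost degree).
[cite: GlazmanManolescu2019, §1, eq. (1); Lemma 2.1, eq. (CR)] -/
def limitWeight (s : Fin 4) (l : List MidEdge) : ℂ :=
  slotLead s * tFiveEighths ^ quarterTurnsL l *
    ((-2 * I * ((Real.sin (5 * π / 4) : ℝ) : ℂ)) ^ cfgCount l [.corner] *
      ((-2 * I * ((Real.sin (5 * π / 4) : ℝ) : ℂ)) * Complex.exp (-(((5 * π / 8 : ℝ) : ℂ) * I))) ^ cfgCount l [.coCorner] *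
      Complex.exp (-(((5 * π / 4 : ℝ) : ℂ) * I)) ^ cfgCount l [.corner, .corner] *
      Complex.exp (((5 * π / 4 : ℝ) : ℂ) * I) ^ cfgCount l [.coCorner, .coCorner])

/-- ★★ **LIMIT FORM OF THE LEADING COEFFICIENT**: within the budget, `lead(termPoly_s(γ)) = lead(Z²·Den)^K ·
limitWeight_s(γ)`. [cite: GlazmanManolescu2019, §1, eq. (1); Lemma 2.1, eq. (CR)] -/
theorem leadingCoeff_termPoly_eq_limitWeight (s : Fin 4) {l : List MidEdge} {K : ℕ} (h : totalExp l ≤ K) :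
    (termPoly s l K).leadingCoeff = ybDenPoly.leadingCoeff ^ K * limitWeight s l := by
  rw [leadingCoeff_termPoly, leadingCoeff_ybU1Poly_eq, leadingCoeff_ybU2Poly_eq, leadingCoeff_ybVPoly, leadingCoeff_ybW1Poly,
    leadingCoeff_ybW2Poly, limitWeight]
  unfold totalExp at h ⊢
  set D := ybDenPoly.leadingCoeff
  have eK : K = (K - (cfgCount l [.corner] + cfgCount l [.coCorner] + cfgCount l [.straight] +
      cfgCount l [.corner, .corner] + cfgCount l [.coCorner, .coCorner])) + cfgCount l [.corner] + cfgCount l [.coCorner] +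
      cfgCount l [.straight] + cfgCount l [.corner, .corner] + cfgCount l [.coCorner, .coCorner] := by omega
  conv_rhs => rw [eK]
  simp only [pow_add, mul_pow]
  ring

/-- A walk term has no coefficient above its degree: `coeff_{4K+1−j}(termPoly_s(γ)) = 0` for `j < cost_s(γ)`.
[cite: GlazmanManolescu2019, §1, eq. (1); Lemma 2.1] -/
theorem termPoly_coeff_eq_zero_of_lt_cost (s : Fin 4) {l : List MidEdge} {K j : ℕ} (h : totalExp l ≤ K)
    (hj : j < cost s l) : (termPoly s l K).coeff (4 * K + 1 - j) = 0 := by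
  apply coeff_eq_zero_of_natDegree_lt
  have := natDegree_termPoly_add_cost s h
  omega

/-- At its own level a walk term shows its leading coefficient: `coeff_{4K+1−cost}(termPoly_s(γ)) = lead`.
[cite: GlazmanManolescu2019, §1, eq. (1); Lemma 2.1] -/
theorem termPoly_coeff_cost (s : Fin 4) {l : List MidEdge} {K : ℕ} (h : totalExp l ≤ K) :
    (termPoly s l K).coeff (4 * K + 1 - cost s l) = (termPoly s l K).leadingCoeff := by
  rw [leadingCoeff, natDegree_termPoly s h]

end Terms

/-! ## Top-down truncation of the cleared vertex functional -/

section Truncation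

variable (Dl : List Face) (a : MidEdge) (f₀ : Face)

/-- Every walk counted at `f₀` is within the budget `K ≥ maxExp`. [cite: GlazmanManolescu2019, Lemma 2.1] -/
theorem totalExp_le_of_maxExp_le {K : ℕ} (hK : maxExp Dl a f₀ ≤ K) (s : Fin 4) (γ : YBWalk (dom Dl) a (slotSide f₀ s)) :
    totalExp γ.mids ≤ K :=
  ((Finset.le_sup (f := fun γ : YBWalk (dom Dl) a (slotSide f₀ s) => totalExp γ.mids) (Finset.mem_univ γ)).trans
    (Finset.le_sup (f := fun s : Fin 4 => maxExpTo Dl a (slotSide f₀ s)) (Finset.mem_univ s))).trans hK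

open Classical in
/-- ★ **THE LIMIT COEFFICIENT at level `j`**: the sum of the leading coefficients of the walk terms of cost exactly `j`.
[cite: GlazmanManolescu2019, Lemma 2.1 and eq. (1)] -/
def limitCoeff (K j : ℕ) : ℂ :=
  ∑ s : Fin 4, ∑ γ ∈ (Finset.univ : Finset (YBWalk (dom Dl) a (slotSide f₀ s))).filter (fun γ => cost s γ.mids = j),
    (termPoly s γ.mids K).leadingCoeff

open Classical in
/-- ★ **The limit coefficient is the level-`j` partition function of the limit model** (times `lead(Z²·Den)^K`).
[cite: GlazmanManolescu2019, Lemma 2.1 and eq. (1)] -/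
theorem limitCoeff_eq_sum_limitWeight {K : ℕ} (hK : maxExp Dl a f₀ ≤ K) (j : ℕ) :
    limitCoeff Dl a f₀ K j = ybDenPoly.leadingCoeff ^ K *
      ∑ s : Fin 4, ∑ γ ∈ (Finset.univ : Finset (YBWalk (dom Dl) a (slotSide f₀ s))).filter (fun γ => cost s γ.mids = j),
        limitWeight s γ.mids := by
  unfold limitCoeff
  rw [Finset.mul_sum]
  refine Finset.sum_congr rfl fun s _ => ?_
  rw [Finset.mul_sum]
  refine Finset.sum_congr rfl fun γ _ => ?_
  exact leadingCoeff_termPoly_eq_limitWeight s (totalExp_le_of_maxExp_le Dl a f₀ hK s γ)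

open Classical in
/-- ★★ **TOP-DOWN TRUNCATION**: the coefficient of `Z^{4K+1−j}` in the cleared vertex functional only sees the walks of
cost at most `j`. [cite: GlazmanManolescu2019, Lemma 2.1 and eq. (1)] -/
theorem ybVFPoly_coeff_eq_sum_filter_cost_le {K : ℕ} (hK : maxExp Dl a f₀ ≤ K) (j : ℕ) :
    (ybVFPoly Dl a f₀ K).coeff (4 * K + 1 - j) =
      ∑ s : Fin 4, ∑ γ ∈ (Finset.univ : Finset (YBWalk (dom Dl) a (slotSide f₀ s))).filter (fun γ => cost s γ.mids ≤ j),
        (termPoly s γ.mids K).coeff (4 * K + 1 - j) := by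
  rw [ybVFPoly_eq_sum_termPoly, finsetSum_coeff]
  refine Finset.sum_congr rfl fun s _ => ?_
  rw [finsetSum_coeff, ← Finset.sum_filter_add_sum_filter_not Finset.univ (fun γ => cost s γ.mids ≤ j)]
  have hz : ∑ γ ∈ (Finset.univ : Finset (YBWalk (dom Dl) a (slotSide f₀ s))).filter (fun γ => ¬cost s γ.mids ≤ j),
      (termPoly s γ.mids K).coeff (4 * K + 1 - j) = 0 := by
    refine Finset.sum_eq_zero fun γ hγ => ?_
    rw [Finset.mem_filter] at hγ
    exact termPoly_coeff_eq_zero_of_lt_cost s (totalExp_le_of_maxExp_le Dl a f₀ hK s γ) (by omega)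
  rw [hz, add_zero]

open Classical in
/-- ★★ **THE COEFFICIENT AT LEVEL `j` = LIMIT COEFFICIENT + LOWER-COST CORRECTIONS**: the walks of cost exactly `j`
contribute their leading coefficients, the walks of smaller cost the `(4K+1−j)`-th coefficients of their terms, and no
other walk contributes. [cite: GlazmanManolescu2019, Lemma 2.1 and eq. (1)] -/
theorem ybVFPoly_coeff_eq_limitCoeff_add {K : ℕ} (hK : maxExp Dl a f₀ ≤ K) (j : ℕ) :
    (ybVFPoly Dl a f₀ K).coeff (4 * K + 1 - j) = limitCoeff Dl a f₀ K j +
      ∑ s : Fin 4, ∑ γ ∈ (Finset.univ : Finset (YBWalk (dom Dl) a (slotSide f₀ s))).filter (fun γ => cost s γ.mids < j),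
        (termPoly s γ.mids K).coeff (4 * K + 1 - j) := by
  rw [ybVFPoly_coeff_eq_sum_filter_cost_le Dl a f₀ hK j, limitCoeff, ← Finset.sum_add_distrib]
  refine Finset.sum_congr rfl fun s _ => ?_
  have hsplit : (Finset.univ : Finset (YBWalk (dom Dl) a (slotSide f₀ s))).filter (fun γ => cost s γ.mids ≤ j) =
      (Finset.univ.filter fun γ => cost s γ.mids = j) ∪ (Finset.univ.filter fun γ => cost s γ.mids < j) := by
    ext γ; simp only [Finset.mem_filter, Finset.mem_univ, true_and, Finset.mem_union]; omega
  have hdisj : Disjoint ((Finset.univ : Finset (YBWalk (dom Dl) a (slotSide f₀ s))).filter fun γ => cost s γ.mids = j)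
      (Finset.univ.filter fun γ => cost s γ.mids < j) := by
    rw [Finset.disjoint_filter]; intro γ _ h; omega
  rw [hsplit, Finset.sum_union hdisj]
  congr 1
  refine Finset.sum_congr rfl fun γ hγ => ?_
  rw [Finset.mem_filter] at hγ
  rw [← hγ.2, termPoly_coeff_cost s (totalExp_le_of_maxExp_le Dl a f₀ hK s γ)]

/-- ★ **DEGREE BOUND BY THE MINIMAL COST**: if every walk counted at `f₀` costs at least `j`, the cleared vertex
functional has degree at most `4K + 1 − j`. [cite: GlazmanManolescu2019, Lemma 2.1 and eq. (1)] -/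
theorem natDegree_ybVFPoly_le_of_le_cost {K j : ℕ} (hK : maxExp Dl a f₀ ≤ K)
    (hj : ∀ (s : Fin 4) (γ : YBWalk (dom Dl) a (slotSide f₀ s)), j ≤ cost s γ.mids) :
    (ybVFPoly Dl a f₀ K).natDegree ≤ 4 * K + 1 - j := by
  rw [ybVFPoly_eq_sum_termPoly]
  refine natDegree_sum_le_of_forall_le _ _ fun s _ => natDegree_sum_le_of_forall_le _ _ fun γ _ => ?_
  have := natDegree_termPoly_add_cost s (K := K) (totalExp_le_of_maxExp_le Dl a f₀ hK s γ)
  have := hj s γ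
  omega

open Classical in
/-- ★★ **AT THE MINIMAL COST LEVEL THE COEFFICIENT IS THE LIMIT COEFFICIENT**: if every walk costs at least `j`, then
`coeff_{4K+1−j}(P) = limitCoeff_j` — the level-`j` partition function of the `Z → ∞` limit model.
[cite: GlazmanManolescu2019, Lemma 2.1 and eq. (1)] -/
theorem ybVFPoly_coeff_eq_limitCoeff_of_le_cost {K j : ℕ} (hK : maxExp Dl a f₀ ≤ K)
    (hj : ∀ (s : Fin 4) (γ : YBWalk (dom Dl) a (slotSide f₀ s)), j ≤ cost s γ.mids) :
    (ybVFPoly Dl a f₀ K).coeff (4 * K + 1 - j) = limitCoeff Dl a f₀ K j := by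
  rw [ybVFPoly_coeff_eq_limitCoeff_add Dl a f₀ hK j]
  conv_rhs => rw [← add_zero (limitCoeff Dl a f₀ K j)]
  congr 1
  refine Finset.sum_eq_zero fun s _ => Finset.sum_eq_zero fun γ hγ => ?_
  rw [Finset.mem_filter] at hγ
  have := hj s γ
  omega

end Truncation

/-! ## The criterion: one non-vanishing coefficient ⇒ finitely many zero angles -/

section Criterion

variable (Dl : List Face) (a : MidEdge) (f₀ : Face)

/-- `Z(θ₁) = Z(θ₂)` with `θ₁, θ₂ ∈ (0, π)` forces `θ₁ = θ₂` (the exponent `3θ/8` moves by less than `2π`). [folklore] -/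
private theorem eq_of_Zθ_eq {θ₁ θ₂ : ℝ} (h₁ : θ₁ ∈ Set.Ioo 0 π) (h₂ : θ₂ ∈ Set.Ioo 0 π) (h : Zθ θ₁ = Zθ θ₂) : θ₁ = θ₂ := by
  obtain ⟨n, hn⟩ := Complex.exp_eq_exp_iff_exists_int.1 h
  have him := congrArg Complex.im hn
  simp only [Complex.mul_im, Complex.ofReal_re, Complex.ofReal_im, Complex.I_re, Complex.I_im, mul_zero, mul_one,
    add_zero, Complex.add_im, Complex.mul_re, Complex.intCast_re, Complex.intCast_im, zero_mul, sub_zero,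
    Complex.re_ofNat, Complex.im_ofNat] at him
  have hb : |(3 * θ₁ / 8 - 3 * θ₂ / 8 : ℝ)| < 2 * π := by
    rw [abs_lt]; constructor <;> nlinarith [h₁.1, h₁.2, h₂.1, h₂.2, Real.pi_pos]
  have hn0 : (n : ℝ) = 0 := by
    by_contra hne
    have h1 : (1 : ℝ) ≤ |(n : ℝ)| := by
      rw [← Int.cast_abs]; exact_mod_cast Int.one_le_abs (fun e => hne (by simp [e]))
    have h2 : 2 * π ≤ |(3 * θ₁ / 8 - 3 * θ₂ / 8 : ℝ)| := by
      rw [show (3 * θ₁ / 8 - 3 * θ₂ / 8 : ℝ) = n * (2 * π) by linarith, abs_mul, abs_of_pos Real.two_pi_pos]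
      nlinarith [Real.pi_pos, h1]
    linarith
  have e : 3 * θ₁ / 8 = 3 * θ₂ / 8 := by
    have := him; rw [hn0, zero_mul, add_zero] at this; exact this
  linarith

/-- ★★ **A NON-ZERO CLEARED POLYNOMIAL HAS FINITELY MANY ZERO ANGLES**: if `ybVFPoly Dl a f₀ K ≠ 0` for some budget
`K ≥ maxExp`, the zero set of the printed vertex functional in `(0, π)` is finite with at most `deg P` elements.
[cite: GlazmanManolescu2019, Lemma 2.1 and eq. (1)] -/
theorem vertexFunctional_printed_zero_set_finite_of_ybVFPoly_ne_zero {K : ℕ} (hK : maxExp Dl a f₀ ≤ K)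
    (hP : ybVFPoly Dl a f₀ K ≠ 0) :
    {θ ∈ Set.Ioo 0 π | vertexFunctional (printedWeights θ) tFiveEighths (ybCoeff θ) Dl a f₀ = 0}.Finite ∧
      {θ ∈ Set.Ioo 0 π | vertexFunctional (printedWeights θ) tFiveEighths (ybCoeff θ) Dl a f₀ = 0}.ncard ≤
        (ybVFPoly Dl a f₀ K).natDegree := by
  set P := ybVFPoly Dl a f₀ K with hPdef
  set S := {θ ∈ Set.Ioo 0 π | vertexFunctional (printedWeights θ) tFiveEighths (ybCoeff θ) Dl a f₀ = 0} with hS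
  have key : ∀ θ ∈ Set.Ioo 0 π, (Zθ θ ^ 2 * ((weightDen θ : ℝ) : ℂ)) ^ K *
      vertexFunctional (printedWeights θ) tFiveEighths (ybCoeff θ) Dl a f₀ = P.eval (Zθ θ) :=
    fun θ hθ => vertexFunctional_printed_eq_eval Dl a f₀ hK (weightDen_ne_zero_of_mem_Ioo hθ)
  have hmaps : ∀ θ ∈ S, Zθ θ ∈ (P.roots.toFinset : Set ℂ) := by
    intro θ hθ
    rw [Finset.mem_coe, Multiset.mem_toFinset, mem_roots hP, IsRoot.def, ← key θ hθ.1, hθ.2, mul_zero]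
  have hinj : Set.InjOn Zθ S := fun θ₁ h₁ θ₂ h₂ h => eq_of_Zθ_eq h₁.1 h₂.1 h
  have hfin : S.Finite :=
    Set.Finite.of_finite_image ((Finset.finite_toSet _).subset (Set.image_subset_iff.2 hmaps)) hinj
  refine ⟨hfin, ?_⟩
  calc S.ncard ≤ (P.roots.toFinset : Set ℂ).ncard := Set.ncard_le_ncard_of_injOn Zθ hmaps hinj
    _ = P.roots.toFinset.card := Set.ncard_coe_finset _
    _ ≤ Multiset.card P.roots := Multiset.toFinset_card_le _
    _ ≤ P.natDegree := card_roots' P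

/-- ★★ **ONE NON-VANISHING COEFFICIENT SUFFICES**: if some coefficient of the cleared vertex functional is non-zero,
the printed vertex functional is not identically zero in the angle — finitely many zeros in `(0, π)`, at most `deg P`.
[cite: GlazmanManolescu2019, Lemma 2.1 and eq. (1)] -/
theorem vertexFunctional_printed_zero_set_finite_of_coeff_ne_zero {K : ℕ} (hK : maxExp Dl a f₀ ≤ K) {d : ℕ}
    (h : (ybVFPoly Dl a f₀ K).coeff d ≠ 0) :
    {θ ∈ Set.Ioo 0 π | vertexFunctional (printedWeights θ) tFiveEighths (ybCoeff θ) Dl a f₀ = 0}.Finite ∧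
      {θ ∈ Set.Ioo 0 π | vertexFunctional (printedWeights θ) tFiveEighths (ybCoeff θ) Dl a f₀ = 0}.ncard ≤
        (ybVFPoly Dl a f₀ K).natDegree :=
  vertexFunctional_printed_zero_set_finite_of_ybVFPoly_ne_zero Dl a f₀ hK (fun e => h (by rw [e, coeff_zero]))

/-- ★★★ **THE LIMIT-COEFFICIENT CRITERION**: if every walk counted at `f₀` costs at least `j` and the level-`j` limit
coefficient — the partition function of the minimal-cost walks in the `Z → ∞` limit model — does not vanish, then the
printed Yang–Baxter vertex functional at `f₀` is NOT identically zero in the angle: its zeros in `(0, π)` are finitely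
many, at most `4K + 1 − j`. [cite: GlazmanManolescu2019, Lemma 2.1 and eq. (1)] -/
theorem vertexFunctional_printed_zero_set_finite_of_limitCoeff_ne_zero {K j : ℕ} (hK : maxExp Dl a f₀ ≤ K)
    (hj : ∀ (s : Fin 4) (γ : YBWalk (dom Dl) a (slotSide f₀ s)), j ≤ cost s γ.mids)
    (h : limitCoeff Dl a f₀ K j ≠ 0) :
    {θ ∈ Set.Ioo 0 π | vertexFunctional (printedWeights θ) tFiveEighths (ybCoeff θ) Dl a f₀ = 0}.Finite ∧
      {θ ∈ Set.Ioo 0 π | vertexFunctional (printedWeights θ) tFiveEighths (ybCoeff θ) Dl a f₀ = 0}.ncard ≤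
        4 * K + 1 - j := by
  have hc : (ybVFPoly Dl a f₀ K).coeff (4 * K + 1 - j) ≠ 0 := by
    rw [ybVFPoly_coeff_eq_limitCoeff_of_le_cost Dl a f₀ hK hj]; exact h
  obtain ⟨hfin, hcard⟩ := vertexFunctional_printed_zero_set_finite_of_coeff_ne_zero Dl a f₀ hK hc
  exact ⟨hfin, hcard.trans (natDegree_ybVFPoly_le_of_le_cost Dl a f₀ hK hj)⟩

/-- ★★ **EXISTENCE FORM**: under the same hypotheses some angle in `(0, π)` has a non-zero vertex functional (indeed
all but finitely many). [cite: GlazmanManolescu2019, Lemma 2.1 and eq. (1)] -/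
theorem exists_vertexFunctional_printed_ne_zero_of_limitCoeff_ne_zero {K j : ℕ} (hK : maxExp Dl a f₀ ≤ K)
    (hj : ∀ (s : Fin 4) (γ : YBWalk (dom Dl) a (slotSide f₀ s)), j ≤ cost s γ.mids)
    (h : limitCoeff Dl a f₀ K j ≠ 0) :
    ∃ θ ∈ Set.Ioo 0 π, vertexFunctional (printedWeights θ) tFiveEighths (ybCoeff θ) Dl a f₀ ≠ 0 := by
  obtain ⟨hfin, -⟩ := vertexFunctional_printed_zero_set_finite_of_limitCoeff_ne_zero Dl a f₀ hK hj h
  by_contra hall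
  push Not at hall
  have hsub : Set.Ioo (0 : ℝ) π ⊆
      {θ ∈ Set.Ioo 0 π | vertexFunctional (printedWeights θ) tFiveEighths (ybCoeff θ) Dl a f₀ = 0} :=
    fun θ hθ => ⟨hθ, hall θ hθ⟩
  exact (Set.Ioo_infinite Real.pi_pos) (hfin.subset hsub)

end Criterion

end Literature.Barriers.CriticalPhenomena.PlaquetteWalk
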